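import Mathlib

/-!
# The period-carrier type of a `g`-dimensional complex torus is inhabited (lit-hodgefound REVIEW-RUNBOOK,
# statement-card binder `Φ : (Fin g ⊕ Fin g → ℝ) ≃L[ℝ] (Fin g → ℂ)`)

Review evidence only (ops-runbook; no new definitions of the theory).  The headline theorems of the
Hodge-foundations lane quantify over a real-linear identification `Φ` of the lattice space `ℝ^{2g}` with
`ℂ^g`; instance synthesis finds no `Nonempty` instance for that carrier, so the runbook's statement card
could not certify mechanically that the quantification is non-vacuous.  Both sides have real dimension
`2g`, so Mathlib's `ContinuousLinearEquiv.ofFinrankEq` inhabits it; we register the `Nonempty` instance.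
-/

namespace Summit.HodgeConjecture.CorCM.Runbook

/-- `ℝ^{2g}` (indexed by `Fin g ⊕ Fin g`) and `ℂ^g` have the same real dimension `2g`. -/
theorem finrank_periodCarrier_eq (g : ℕ) :
    Module.finrank ℝ (Fin g ⊕ Fin g → ℝ) = Module.finrank ℝ (Fin g → ℂ) := by
  simp [Module.finrank_pi_fintype, Complex.finrank_real_complex, Fintype.card_sum]
  ring

/-- Hence the period-carrier type `(Fin g ⊕ Fin g → ℝ) ≃L[ℝ] (Fin g → ℂ)` is inhabited: the binder `Φ`
of the lane's torus theorems ranges over a non-empty type. -/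
instance nonempty_periodCarrier (g : ℕ) : Nonempty ((Fin g ⊕ Fin g → ℝ) ≃L[ℝ] (Fin g → ℂ)) :=
  ⟨ContinuousLinearEquiv.ofFinrankEq (finrank_periodCarrier_eq g)⟩

/-- The `g = 2` instance used by `ComplexTorus.finrank_neronSeveriGroup_eq_four_iff` (complex 2-tori). -/
theorem nonempty_periodCarrier_two : Nonempty ((Fin 2 ⊕ Fin 2 → ℝ) ≃L[ℝ] (Fin 2 → ℂ)) :=
  inferInstance

end Summit.HodgeConjecture.CorCM.Runbook
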